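import Mathlib
import Summits.MatrixMultiplication.MatrixMultiplication.Theses.OctonionicLaser
import Summits.MatrixMultiplication.MatrixMultiplication.Theorems.OctonionicLaserDefs
import Summits.MatrixMultiplication.MatrixMultiplication.Theorems.OctonionicLaserOctAsymptoticRankStubOctonionBasis
import Summits.MatrixMultiplication.MatrixMultiplication.Theorems.AsymptoticRankCWBPerm3Form
import Literature.Computability.AlgebraicComplexity.AsymptoticRankBorderRank
import Literature.Computability.AlgebraicComplexity.BorderRankRestriction
import Literature.Computability.AlgebraicComplexity.GroupAlgebraTensor
import Literature.Computability.AlgebraicComplexity.TensorRestrictionRank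
import Literature.Barriers.MatrixMultiplication.UniversalMethodBarrierAsymptoticRank

/-!
# `OctAsymptoticRank` (stmt-MatrixMultiplication-7930), line `birth` — the currency change is exact:
# `t₈ ≥ 𝕊` (converse transfer) and `(i) ⟺ border-rank power milestones`

Route `OctonionicLaser`, crux `OctAsymptoticRank : R̃(t₈) ≤ 8` (`t₈ = octT ℂ`, the complex octonions
as the Cayley–Dickson double of `M₂(ℂ)`).  The registered skeleton `Cruxes/OctAsymptoticRank/Lines/
birth.lean` concludes the crux from two stubs: the transfer `𝕊 ≥ t₈` (`stub_octonionBasis`, LANDED in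
`OctonionicLaserOctAsymptoticRankStubOctonionBasis.lean`), `𝕊` the signed `𝔽₂³` multiplication
table of the octonions, and the border-rank power milestones of `𝕊`,
`∀ δ > 0, ∃ k ≥ 1, bR(𝕊^{⊠k}) ≤ (8(1+δ))^k` (`stub_powerMilestones`, open).  This support file makes
the skeleton's "honest status" paragraph a theorem:

* `octT_restrictsTo_signedTable` — the CONVERSE transfer `t₈ ≥ 𝕊`
  (`TensorRestrictsTo (octT ℂ) 𝕊`), by the inverse change of basis: with the Gaussian-integer tables
  `tabA = M⁻¹`, `tab2M = 2M` of the landed stub, `𝕊 w x y = ∑_{o,p,q} M[w,o] · M⁻¹[p,x] · M⁻¹[q,y] ·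
  octT o p q`; the two cleared identities behind it — the columns of `M⁻¹` multiply like octonions
  (`keyU`, `512` Gaussian-integer identities of `64` terms) and `2M · M⁻¹ = 2·I` (`keyMI`) — are kernel
  computations (`decide +kernel`).  Hence `𝕊` and `t₈` are
  restriction-equivalent, so `R`, `bR` of all Kronecker powers and `R̃` agree
  (`tensorRank_kroneckerPow_signedTable_eq`, `algBorderRank_kroneckerPow_signedTable_eq`,
  `asymptoticRank_signedTable_eq`).
* `milestones_of_asymptoticRank_le` — for ANY tensor `s` over `ℂ` and `r > 0`: `R̃(s) ≤ r` implies the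
  milestones `∀ δ > 0, ∃ k ≥ 1, bR(s^{⊠k}) ≤ (r(1+δ))^k` (no Fekete needed: `R̃` IS the infimum of
  `R(s^{⊠k})^{1/k}`, and `bR ≤ R`); with the skeleton's composition
  `asymptoticRank_le_of_restrictsTo_of_milestones` (re-homed here, sorry-free, for ANY `s ≥ t`, over the
  landed `pow_asymptoticRank_le_asymptoticRank_kroneckerPow` of `AsymptoticRankCWBPerm3Form.lean`) this
  gives `milestones_iff_asymptoticRank_le` for restriction-equivalent pairs.
* `octAsymptoticRank_iff_signedTable_milestones`, `octAsymptoticRank_iff_milestones` — the crux BY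
  NAME is equivalent to the milestones of `𝕊`, and to those of `t₈` itself: the registered stub
  `stub_powerMilestones` is exactly as strong as the crux (neither a weakening nor a strengthening),
  which is what a refuter or the disprover must know before attacking it.

Sources: M. Christandl, P. Vrana, J. Zuiddam, J. Amer. Math. Soc. 36 (2023), §1.1 (restriction,
Kronecker powers, `R̃` as an infimum) [ChristandlVranaZuiddam2023]; P. Bürgisser, M. Clausen,
M. A. Shokrollahi, *Algebraic Complexity Theory* (1997), Lemma (15.27) (`R̃ ≤ bR`)
[BurgisserClausenShokrollahi1997]; M. Bläser, *Fast Matrix Multiplication* (2013), Def. 6.1,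
Rem. 6.2 (`bR ≤ R`) [Blaser2013]; H. Albuquerque, S. Majid, J. Algebra 220 (1999), Prop. 3.1 (the
cocycle) [AlbuquerqueMajid1999].  No fact is cited as a hypothesis; the file declares no definition.
-/

-- single-conjunct summit: the mandated namespace repeats MatrixMultiplication.
set_option linter.dupNamespace false

noncomputable section

namespace Summit.MatrixMultiplication.MatrixMultiplication.Theorems

namespace OctAsymptoticRank

open Literature.Computability.AlgebraicComplexity
open Literature.Barriers.MatrixMultiplication (asymptoticRank_le_of_polyDegeneratesTo)
open Summit.MatrixMultiplication.MatrixMultiplication.Theorems.OctonionicLaser (octT octEnc octTab)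
open Summit.MatrixMultiplication.MatrixMultiplication.Theses.OctonionicLaser (OctAsymptoticRank)

/-! ## General facts: milestones versus asymptotic rank -/

section General

variable {ι κ μ ι' κ' μ' : Type} [Fintype ι] [Fintype κ] [Fintype μ] [Fintype ι'] [Fintype κ']
  [Fintype μ'] [DecidableEq ι] [DecidableEq κ] [DecidableEq μ] [DecidableEq ι'] [DecidableEq κ']
  [DecidableEq μ']

/-- **Milestones ⇒ asymptotic rank** (the skeleton's composition, for ANY tensors `s ≥ t` and any
target `r ≥ 0`): if `s` restricts to `t` and the Kronecker powers of `s` have border-rank milestones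
`bR(s^{⊠k}) ≤ (r(1+δ))^k` (`k ≥ 1`, every `δ > 0`), then `R̃(t) ≤ r`.  Proof: `R̃(t) ≤ R̃(s)`
(degeneration monotonicity), `R̃(s)^k ≤ R̃(s^{⊠k})` (landed
`pow_asymptoticRank_le_asymptoticRank_kroneckerPow`) `≤ bR(s^{⊠k}) ≤ (r(1+δ))^k` (BCS Lemma 15.27),
so `R̃(s) ≤ r(1+δ)` for all `δ > 0`; index types in `Type`. [folklore] -/
theorem asymptoticRank_le_of_restrictsTo_of_milestones {s : ι → κ → μ → ℂ} {t : ι' → κ' → μ' → ℂ}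
    (hst : TensorRestrictsTo s t) (r : ℝ) (hr : 0 ≤ r)
    (hmil : ∀ δ : ℝ, 0 < δ → ∃ k : ℕ, 1 ≤ k ∧
      (algBorderRank (kroneckerPow s k) : ℝ) ≤ (r * (1 + δ)) ^ k) :
    asymptoticRank t ≤ r := by
  -- `R̃(t) ≤ R̃(s)`: a restriction is a degeneration and `R̃` is monotone under degeneration
  have hts : asymptoticRank t ≤ asymptoticRank s :=
    asymptoticRank_le_of_polyDegeneratesTo hst.polyDegeneratesTo
  refine hts.trans ?_
  -- `R̃(s) ≤ r (1 + δ)` for every `δ > 0`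
  have hδ : ∀ δ : ℝ, 0 < δ → asymptoticRank s ≤ r * (1 + δ) := by
    intro δ hδ
    obtain ⟨k, hk, hbd⟩ := hmil δ hδ
    have hk0 : 0 < k := hk
    have h1 : asymptoticRank s ^ k ≤ (r * (1 + δ)) ^ k :=
      calc asymptoticRank s ^ k ≤ asymptoticRank (kroneckerPow s k) :=
            pow_asymptoticRank_le_asymptoticRank_kroneckerPow s hk0
        _ ≤ algBorderRank (kroneckerPow s k) := asymptoticRank_le_algBorderRank _
        _ ≤ (r * (1 + δ)) ^ k := hbd
    exact le_of_pow_le_pow_left₀ hk0.ne' (by positivity) h1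
  -- let `δ → 0`
  refine le_of_forall_pos_le_add fun ε hε => ?_
  have hr1 : 0 < r + 1 := by linarith
  have h := hδ (ε / (r + 1)) (by positivity)
  have key : r * (ε / (r + 1)) ≤ ε := by
    rw [mul_div_assoc', div_le_iff₀ hr1]
    nlinarith
  calc asymptoticRank s ≤ r * (1 + ε / (r + 1)) := h
    _ = r + r * (ε / (r + 1)) := by ring
    _ ≤ r + ε := by linarith

omit [DecidableEq ι] [DecidableEq κ] [DecidableEq μ] in
/-- **Asymptotic rank ⇒ milestones** (the converse; no Fekete lemma is needed): if `R̃(s) ≤ r` with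
`r > 0` then for every `δ > 0` some Kronecker power `s^{⊠k}`, `k ≥ 1`, has `bR(s^{⊠k}) ≤ (r(1+δ))^k` —
because `R̃(s) = inf_k R(s^{⊠k})^{1/k} < r(1+δ)` is an infimum (CVZ §1.1), so some term lies below
`r(1+δ)`, and `bR ≤ R` (Bläser Rem. 6.2). [folklore] -/
theorem milestones_of_asymptoticRank_le {s : ι → κ → μ → ℂ} {r : ℝ} (hr : 0 < r)
    (h : asymptoticRank s ≤ r) :
    ∀ δ : ℝ, 0 < δ → ∃ k : ℕ, 1 ≤ k ∧
      (algBorderRank (kroneckerPow s k) : ℝ) ≤ (r * (1 + δ)) ^ k := by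
  intro δ hδ
  have hlt : asymptoticRank s < r * (1 + δ) :=
    h.trans_lt (lt_mul_of_one_lt_right hr (by linarith))
  obtain ⟨N, hN⟩ := exists_lt_of_ciInf_lt hlt
  refine ⟨N + 1, Nat.le_add_left 1 N, ?_⟩
  set x : ℝ := (tensorRank (kroneckerPow s (N + 1)) : ℝ) with hx_def
  have hx : 0 ≤ x := Nat.cast_nonneg _
  have hN' : x ^ ((N : ℝ) + 1)⁻¹ < r * (1 + δ) := hN
  have hxe : 0 ≤ x ^ ((N : ℝ) + 1)⁻¹ := Real.rpow_nonneg hx _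
  have hN1 : ((N : ℝ) + 1) ≠ 0 := by positivity
  have hxeq : (x ^ ((N : ℝ) + 1)⁻¹) ^ (N + 1) = x := by
    rw [← Real.rpow_natCast, ← Real.rpow_mul hx]
    push_cast
    rw [inv_mul_cancel₀ hN1, Real.rpow_one]
  have hR : x ≤ (r * (1 + δ)) ^ (N + 1) := by
    rw [← hxeq]
    exact pow_le_pow_left₀ hxe hN'.le _
  calc (algBorderRank (kroneckerPow s (N + 1)) : ℝ) ≤ x := by
        rw [hx_def]
        exact_mod_cast algBorderRank_le_tensorRank _
    _ ≤ (r * (1 + δ)) ^ (N + 1) := hR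

/-- **Milestones ⟺ asymptotic rank** for a restriction-equivalent pair `s ≥ t ≥ s` and a target
`r > 0`: the border-rank power milestones of `s` at rate `r` hold iff `R̃(t) ≤ r`. [folklore] -/
theorem milestones_iff_asymptoticRank_le {s : ι → κ → μ → ℂ} {t : ι' → κ' → μ' → ℂ}
    (hst : TensorRestrictsTo s t) (hts : TensorRestrictsTo t s) {r : ℝ} (hr : 0 < r) :
    (∀ δ : ℝ, 0 < δ → ∃ k : ℕ, 1 ≤ k ∧
        (algBorderRank (kroneckerPow s k) : ℝ) ≤ (r * (1 + δ)) ^ k) ↔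
      asymptoticRank t ≤ r :=
  ⟨asymptoticRank_le_of_restrictsTo_of_milestones hst r hr.le, fun h =>
    milestones_of_asymptoticRank_le hr
      ((asymptoticRank_le_of_polyDegeneratesTo hts.polyDegeneratesTo).trans h)⟩

/-- Restriction-equivalent tensors have the same asymptotic rank. [folklore] -/
theorem asymptoticRank_eq_of_restrictsTo {s : ι → κ → μ → ℂ} {t : ι' → κ' → μ' → ℂ}
    (hst : TensorRestrictsTo s t) (hts : TensorRestrictsTo t s) :
    asymptoticRank s = asymptoticRank t :=
  le_antisymm (asymptoticRank_le_of_polyDegeneratesTo hts.polyDegeneratesTo)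
    (asymptoticRank_le_of_polyDegeneratesTo hst.polyDegeneratesTo)

end General

/-! ## The converse transfer `t₈ ≥ 𝕊` -/

/-- The imaginary unit `i = ⟨0, 1⟩` of the Gaussian integers `ℤ[i]`. -/
local notation "𝒊" => (⟨0, 1⟩ : GaussianInt)

/-- `tabA = M⁻¹` (rows: the output index `o` of `t₈`; columns: `z ∈ 𝔽₂³`; both encoded by `octEnc`),
entries in `{0, ±1, ±i}` — the same table as in the landed stub file; its COLUMNS are the octonion
basis vectors `e_z` written in the graded matrix units of `t₈`. -/
local notation "tabA" =>
  (![![1, 𝒊, 0, 0, 0, 0, 0, 0],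
     ![0, 0, 1, 𝒊, 0, 0, 0, 0],
     ![0, 0, -1, 𝒊, 0, 0, 0, 0],
     ![1, -𝒊, 0, 0, 0, 0, 0, 0],
     ![0, 0, 0, 0, 1, 𝒊, 0, 0],
     ![0, 0, 0, 0, 0, 0, 1, -𝒊],
     ![0, 0, 0, 0, 0, 0, -1, -𝒊],
     ![0, 0, 0, 0, 1, -𝒊, 0, 0]] : Fin 8 → Fin 8 → GaussianInt)

/-- `tab2M = 2M` (rows: `z ∈ 𝔽₂³`; columns: an index `o` of `t₈`; both encoded by `octEnc`),
entries in `{0, ±1, ±i}` — the same table as in the landed stub file; `tab2M · tabA = 2·I`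
(`keyMI`). -/
local notation "tab2M" =>
  (![![1, 0, 0, 1, 0, 0, 0, 0],
     ![-𝒊, 0, 0, 𝒊, 0, 0, 0, 0],
     ![0, 1, -1, 0, 0, 0, 0, 0],
     ![0, -𝒊, -𝒊, 0, 0, 0, 0, 0],
     ![0, 0, 0, 0, 1, 0, 0, 1],
     ![0, 0, 0, 0, -𝒊, 0, 0, 𝒊],
     ![0, 0, 0, 0, 0, 1, -1, 0],
     ![0, 0, 0, 0, 0, 𝒊, 𝒊, 0]] : Fin 8 → Fin 8 → GaussianInt)

set_option maxHeartbeats 4000000 in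
/-- **Kernel certificate 1 — the columns of `M⁻¹` multiply like octonions**: in the graded
matrix-unit coordinates of `t₈`, `e_x · e_y = (−1)^{f(x,y)} e_{x+y}` where `e_z = ∑_o M⁻¹[o, z] b_o`,
i.e. `∑_{p,q} M⁻¹[p, x] · M⁻¹[q, y] · octTab o p q = (−1)^{f(x,y)} · M⁻¹[o, x + y]` (`512`
Gaussian-integer identities of `64` terms, `decide +kernel`). [folklore] -/
theorem keyU : ∀ o x y : Fin 2 × Fin 2 × Fin 2,
    ∑ p : Fin 2 × Fin 2 × Fin 2, ∑ q : Fin 2 × Fin 2 × Fin 2,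
        tabA (octEnc p) (octEnc x) * tabA (octEnc q) (octEnc y) * (octTab o p q : GaussianInt) =
      (if x.1 * y.1 + x.1 * y.2.1 + x.1 * y.2.2 + x.2.1 * y.2.1 + x.2.1 * y.2.2 + x.2.2 * y.2.2
                + y.1 * x.2.1 * x.2.2 + x.1 * y.2.1 * x.2.2 + x.1 * x.2.1 * y.2.2 = (1 : Fin 2)
        then (-1 : GaussianInt) else (1 : GaussianInt)) * tabA (octEnc o) (octEnc (x + y)) := by
  decide +kernel

/-- **Kernel certificate 2 — `2M · M⁻¹ = 2·I`**: `∑_o 2M[w, o] · M⁻¹[o, z] = 2 [w = z]`. [folklore] -/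
theorem keyMI : ∀ w z : Fin 2 × Fin 2 × Fin 2,
    ∑ o : Fin 2 × Fin 2 × Fin 2, tab2M (octEnc w) (octEnc o) * tabA (octEnc o) (octEnc z) =
      if w = z then (2 : GaussianInt) else 0 := by
  decide +kernel

/-- **The converse transfer `t₈ ≥ 𝕊`**: the route's complex-octonion tensor `t₈ = octT ℂ` restricts
to the signed `𝔽₂³` table, `𝕊 w x y = ∑_{o,p,q} A w o · B x p · C y q · octT ℂ o p q` with
`A w o = M[w, o] = 2M[w, o] / 2`, `B x p = M⁻¹[p, x]`, `C y q = M⁻¹[q, y]` read in `ℂ` through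
`GaussianInt.toComplex` (the inverse change of basis to `stub_octonionBasis`): the inner `(p, q)`-sum
is `keyU`, the remaining `o`-sum is `keyMI`. [folklore] -/
theorem octT_restrictsTo_signedTable :
    Literature.Computability.AlgebraicComplexity.TensorRestrictsTo
      (Summit.MatrixMultiplication.MatrixMultiplication.Theorems.OctonionicLaser.octT ℂ)
      (fun z x y : Fin 2 × Fin 2 × Fin 2 =>
        if z = x + y then
          (if x.1 * y.1 + x.1 * y.2.1 + x.1 * y.2.2 + x.2.1 * y.2.1 + x.2.1 * y.2.2 + x.2.2 * y.2.2
                + y.1 * x.2.1 * x.2.2 + x.1 * y.2.1 * x.2.2 + x.1 * x.2.1 * y.2.2 = (1 : Fin 2)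
            then (-1 : ℂ) else (1 : ℂ))
        else (0 : ℂ)) := by
  refine ⟨fun w o => GaussianInt.toComplex (tab2M (octEnc w) (octEnc o)) / 2,
    fun x p => GaussianInt.toComplex (tabA (octEnc p) (octEnc x)),
    fun y q => GaussianInt.toComplex (tabA (octEnc q) (octEnc y)), fun w x y => ?_⟩
  beta_reduce
  -- certificate 1 read in `ℂ`: the inner `(p, q)`-sum
  have hU : ∀ o : Fin 2 × Fin 2 × Fin 2,
      ∑ p : Fin 2 × Fin 2 × Fin 2, ∑ q : Fin 2 × Fin 2 × Fin 2,
          GaussianInt.toComplex (tabA (octEnc p) (octEnc x)) *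
            GaussianInt.toComplex (tabA (octEnc q) (octEnc y)) * octT ℂ o p q =
        (if x.1 * y.1 + x.1 * y.2.1 + x.1 * y.2.2 + x.2.1 * y.2.1 + x.2.1 * y.2.2 + x.2.2 * y.2.2
                + y.1 * x.2.1 * x.2.2 + x.1 * y.2.1 * x.2.2 + x.1 * x.2.1 * y.2.2 = (1 : Fin 2)
            then (-1 : ℂ) else (1 : ℂ)) *
          GaussianInt.toComplex (tabA (octEnc o) (octEnc (x + y))) := by
    intro o
    have h := congrArg GaussianInt.toComplex (keyU o x y)
    simp only [map_sum, map_mul, map_intCast, apply_ite GaussianInt.toComplex, map_neg,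
      map_one] at h
    simp only [octT_complex_eq_octTab]
    exact h
  -- certificate 2 read in `ℂ`: the `o`-sum
  have hMI : ∑ o : Fin 2 × Fin 2 × Fin 2, GaussianInt.toComplex (tab2M (octEnc w) (octEnc o)) *
      GaussianInt.toComplex (tabA (octEnc o) (octEnc (x + y))) = if w = x + y then (2 : ℂ) else 0 := by
    have h := congrArg GaussianInt.toComplex (keyMI w (x + y))
    simp only [map_sum, map_mul, apply_ite GaussianInt.toComplex, map_ofNat, map_zero] at h
    exact h
  -- reshape the triple sum as `∑_o A w o · (∑_{p,q} B x p · C y q · t₈ o p q)`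
  have hre : ∑ o : Fin 2 × Fin 2 × Fin 2, ∑ p : Fin 2 × Fin 2 × Fin 2, ∑ q : Fin 2 × Fin 2 × Fin 2,
      GaussianInt.toComplex (tab2M (octEnc w) (octEnc o)) / 2 *
        GaussianInt.toComplex (tabA (octEnc p) (octEnc x)) *
        GaussianInt.toComplex (tabA (octEnc q) (octEnc y)) * octT ℂ o p q =
      ∑ o : Fin 2 × Fin 2 × Fin 2, GaussianInt.toComplex (tab2M (octEnc w) (octEnc o)) / 2 *
        ∑ p : Fin 2 × Fin 2 × Fin 2, ∑ q : Fin 2 × Fin 2 × Fin 2,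
          GaussianInt.toComplex (tabA (octEnc p) (octEnc x)) *
            GaussianInt.toComplex (tabA (octEnc q) (octEnc y)) * octT ℂ o p q := by
    refine Finset.sum_congr rfl fun o _ => ?_
    rw [Finset.mul_sum]
    refine Finset.sum_congr rfl fun p _ => ?_
    rw [Finset.mul_sum]
    refine Finset.sum_congr rfl fun q _ => ?_
    ring
  rw [hre]
  simp_rw [hU]
  have hout : ∑ o : Fin 2 × Fin 2 × Fin 2, GaussianInt.toComplex (tab2M (octEnc w) (octEnc o)) / 2 *
      ((if x.1 * y.1 + x.1 * y.2.1 + x.1 * y.2.2 + x.2.1 * y.2.1 + x.2.1 * y.2.2 + x.2.2 * y.2.2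
                + y.1 * x.2.1 * x.2.2 + x.1 * y.2.1 * x.2.2 + x.1 * x.2.1 * y.2.2 = (1 : Fin 2)
            then (-1 : ℂ) else (1 : ℂ)) *
        GaussianInt.toComplex (tabA (octEnc o) (octEnc (x + y)))) =
      (if x.1 * y.1 + x.1 * y.2.1 + x.1 * y.2.2 + x.2.1 * y.2.1 + x.2.1 * y.2.2 + x.2.2 * y.2.2
                + y.1 * x.2.1 * x.2.2 + x.1 * y.2.1 * x.2.2 + x.1 * x.2.1 * y.2.2 = (1 : Fin 2)
            then (-1 : ℂ) else (1 : ℂ)) / 2 *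
        ∑ o : Fin 2 × Fin 2 × Fin 2, GaussianInt.toComplex (tab2M (octEnc w) (octEnc o)) *
          GaussianInt.toComplex (tabA (octEnc o) (octEnc (x + y))) := by
    rw [Finset.mul_sum]
    refine Finset.sum_congr rfl fun o _ => ?_
    ring
  rw [hout, hMI]
  split_ifs <;> ring

/-- `R(𝕊^{⊠k}) = R(t₈^{⊠k})` for every `k` (restriction-equivalence, `TensorRestrictsTo.kroneckerPow`,
`TensorRestrictsTo.tensorRank_le`). [folklore] -/
theorem tensorRank_kroneckerPow_signedTable_eq (k : ℕ) :
    tensorRank (kroneckerPow (fun z x y : Fin 2 × Fin 2 × Fin 2 =>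
        if z = x + y then
          (if x.1 * y.1 + x.1 * y.2.1 + x.1 * y.2.2 + x.2.1 * y.2.1 + x.2.1 * y.2.2 + x.2.2 * y.2.2
                + y.1 * x.2.1 * x.2.2 + x.1 * y.2.1 * x.2.2 + x.1 * x.2.1 * y.2.2 = (1 : Fin 2)
            then (-1 : ℂ) else (1 : ℂ))
        else (0 : ℂ)) k) = tensorRank (kroneckerPow (octT ℂ) k) :=
  le_antisymm ((octT_restrictsTo_signedTable.kroneckerPow k).tensorRank_le)
    ((stub_octonionBasis.kroneckerPow k).tensorRank_le)

/-- `bR(𝕊^{⊠k}) = bR(t₈^{⊠k})` for every `k` (restriction-equivalence,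
`TensorRestrictsTo.algBorderRank_le`). [folklore] -/
theorem algBorderRank_kroneckerPow_signedTable_eq (k : ℕ) :
    algBorderRank (kroneckerPow (fun z x y : Fin 2 × Fin 2 × Fin 2 =>
        if z = x + y then
          (if x.1 * y.1 + x.1 * y.2.1 + x.1 * y.2.2 + x.2.1 * y.2.1 + x.2.1 * y.2.2 + x.2.2 * y.2.2
                + y.1 * x.2.1 * x.2.2 + x.1 * y.2.1 * x.2.2 + x.1 * x.2.1 * y.2.2 = (1 : Fin 2)
            then (-1 : ℂ) else (1 : ℂ))
        else (0 : ℂ)) k) = algBorderRank (kroneckerPow (octT ℂ) k) :=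
  le_antisymm ((octT_restrictsTo_signedTable.kroneckerPow k).algBorderRank_le)
    ((stub_octonionBasis.kroneckerPow k).algBorderRank_le)

/-- `R̃(𝕊) = R̃(t₈)`. [folklore] -/
theorem asymptoticRank_signedTable_eq :
    asymptoticRank (fun z x y : Fin 2 × Fin 2 × Fin 2 =>
        if z = x + y then
          (if x.1 * y.1 + x.1 * y.2.1 + x.1 * y.2.2 + x.2.1 * y.2.1 + x.2.1 * y.2.2 + x.2.2 * y.2.2
                + y.1 * x.2.1 * x.2.2 + x.1 * y.2.1 * x.2.2 + x.1 * x.2.1 * y.2.2 = (1 : Fin 2)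
            then (-1 : ℂ) else (1 : ℂ))
        else (0 : ℂ)) = asymptoticRank (octT ℂ) :=
  asymptoticRank_eq_of_restrictsTo stub_octonionBasis octT_restrictsTo_signedTable

/-! ## The crux is exactly the milestones -/

/-- **`OctAsymptoticRank ⟺` the border-rank power milestones of the signed table** (the registered
stub `stub_powerMilestones` of `Lines/birth.lean` is equivalent to the crux it serves: `⇐` is the
skeleton's composition through `stub_octonionBasis`, `⇒` is `milestones_of_asymptoticRank_le` through
the converse transfer). [folklore] -/
theorem octAsymptoticRank_iff_signedTable_milestones :
    OctAsymptoticRank ↔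
      ∀ δ : ℝ, 0 < δ → ∃ k : ℕ, 1 ≤ k ∧
        (algBorderRank (kroneckerPow (fun z x y : Fin 2 × Fin 2 × Fin 2 =>
        if z = x + y then
          (if x.1 * y.1 + x.1 * y.2.1 + x.1 * y.2.2 + x.2.1 * y.2.1 + x.2.1 * y.2.2 + x.2.2 * y.2.2
                + y.1 * x.2.1 * x.2.2 + x.1 * y.2.1 * x.2.2 + x.1 * x.2.1 * y.2.2 = (1 : Fin 2)
            then (-1 : ℂ) else (1 : ℂ))
        else (0 : ℂ)) k) : ℝ) ≤ ((8 : ℝ) * (1 + δ)) ^ k :=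
  (milestones_iff_asymptoticRank_le stub_octonionBasis octT_restrictsTo_signedTable
    (by norm_num : (0 : ℝ) < 8)).symm

/-- **`OctAsymptoticRank ⟺` the border-rank power milestones of `t₈` itself**:
`R̃(t₈) ≤ 8 ↔ ∀ δ > 0, ∃ k ≥ 1, bR(t₈^{⊠k}) ≤ (8(1+δ))^k`. [folklore] -/
theorem octAsymptoticRank_iff_milestones :
    OctAsymptoticRank ↔
      ∀ δ : ℝ, 0 < δ → ∃ k : ℕ, 1 ≤ k ∧
        (algBorderRank (kroneckerPow (octT ℂ) k) : ℝ) ≤ ((8 : ℝ) * (1 + δ)) ^ k :=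
  (milestones_iff_asymptoticRank_le (TensorRestrictsTo.refl (octT ℂ)) (TensorRestrictsTo.refl _)
    (by norm_num : (0 : ℝ) < 8)).symm

end OctAsymptoticRank

end Summit.MatrixMultiplication.MatrixMultiplication.Theorems

end
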